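import Literature.IUT.HodgeTheaters.KitS5LocalOfDatumGluing
import Literature.IUT.HodgeTheaters.KitIsoKitOfDatum
import HarnessLib

/-!
# [IUTchI] Rmk 6.12.2 (ii) / Def 6.13 for ΘNF-Hodge theaters of Definition 5.5: the §6 uniqueness statements,
# specialised BY NAME to the kit `S5Local.ofDatum` built from abc-iut-L5-t3's typing (proofs only)

S. Mochizuki, *Inter-universal Teichmüller theory I*, kurims manuscript (May 2020): Remark 6.12.2 (ii) p. 174 ("by
Proposition 4.8, (ii); Corollary 5.6, (ii), the gluing isomorphism that occurs in such a gluing operation is unique"),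
Definition 6.13 (i)(c), (ii)(c) pp. 182–183 ([IUTchI] Rmk 6.12.2 (ii) p.174) [claim: Mochizuki2012, status: disputed]
(D-0012 claim key, series status DISPUTED; PROOF-ONLY companion, every statement a by-name specialisation of landed
theorems; nothing of the series is asserted, no side is taken on [IUTchIII] Cor. 3.12).

abc-iut-L5-t4 / abc-iut-L5-t5 / abc-iut-w4-d056 typed and proved the §6 uniqueness statements for an ARBITRARY ΘNF-side
kit `N : K.S5Local M FK` with ARBITRARY `IsoKit`; `KitCoreBridge.lean` derived them from the §4 typing for kits of a
§4 datum.  Here `N := S5Local.ofDatum S fc nl` (`KitS5LocalOfDatum.lean`: ΘNF-Hodge theaters := abc-iut-L5-t3's REAL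
`ThetaNFHodgeTheater S` of Def 5.5 (iii)) and `NI := IsoKit.ofDatum fc nl` (`KitIsoKitOfDatum.lean`): the statements
become theorems about DEFINITION 5.5 HODGE THEATERS —

* `ofDatum_gluingUniqueBad`, `ofDatum_gluingUnique` — Rmk 6.12.2 (ii) / Def 6.13 (i)(c) (`GluingUnique(Bad)`);
* `ofDatum_dGluing_subsingleton` — Def 6.13 (ii)(c): the `𝒟`-gluing of the associated `𝒟`-ΘNF-Hodge theater of a
  Def 5.5 (iii) theater to a `𝒟-Θ^±`-bridge is unique;
* `ofDatum_gluing_subsingleton` — Def 6.13 (i)(c): the gluing of a Def 5.5 (iii) ΘNF-Hodge theater to a Θ^±-bridge is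
  unique (ℱ-level, through `IsoKit.ofDatum`);
* `ofDatum_gluingTransportLaw_and_gluingUniqueBad` — the two §6 hypotheses on the ΘNF side recorded by abc-iut-L5-t4
  (`GluingTransportLaw`, `GluingUniqueBad`) hold TOGETHER for `ofDatum`.

Hypotheses: the dictionaries and `hM : c.ThetaAgrees M` (and a bad place of the kit where the unguarded forms need one).
-/

namespace Literature.IUT.HodgeTheaters

open CategoryTheory

universe u

namespace BaseThetaDatum.S5Local

variable {𝔡 : BaseThetaDatum.{u+1}} {K : PMBaseKit.{u+1} 𝔡.l} {S : S5Local 𝔡} {c : 𝔡.KitCore K} {M : K.MultKit}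
  {FK : K.FKit M} (fc : S.FKitCore c FK) (nl : c.NFLink)

/-- **[IUTchI] Rmk 6.12.2 (ii), guarded form, for Def 5.5 theaters**: `GluingUniqueBad` holds for the kit built from
abc-iut-L5-t3's typing (abc-iut-L5-t5's guard `𝕍^bad ≠ ∅ → GluingUnique`; `KitCore.gluingUniqueBad`).
([IUTchI] Rmk 6.12.2 (ii) p.174) [claim: Mochizuki2012, status: disputed] -/
theorem ofDatum_gluingUniqueBad (hM : c.ThetaAgrees M) (hl : Odd 𝔡.l) : (ofDatum fc nl).GluingUniqueBad hl :=
  KitCore.gluingUniqueBad hM hl (ofDatum fc nl)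

/-- **[IUTchI] Rmk 6.12.2 (ii) / Def 6.13 (i)(c) for Def 5.5 theaters**: given a bad place of the kit, abc-iut-L5-t4's
`GluingUnique` holds for the kit built from abc-iut-L5-t3's typing (`KitCore.gluingUnique`).
([IUTchI] Def 6.13 (i) p.182) [claim: Mochizuki2012, status: disputed] -/
theorem ofDatum_gluingUnique (hM : c.ThetaAgrees M) (hl : Odd 𝔡.l) {x : K.V} (hx : x ∈ K.bad) :
    (ofDatum fc nl).GluingUnique hl :=
  KitCore.gluingUnique hM hl (ofDatum fc nl) hx

/-- For kits indexed by ALL of `𝕍` (the dictionary's `e` onto) the bad place comes from Def 3.1 (b):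
`GluingUnique` outright. ([IUTchI] Def 6.13 (i) p.182) [claim: Mochizuki2012, status: disputed] -/
theorem ofDatum_gluingUnique_of_surjective (hM : c.ThetaAgrees M) (he : Function.Surjective c.e) (hl : Odd 𝔡.l) :
    (ofDatum fc nl).GluingUnique hl :=
  KitCore.gluingUnique_of_surjective hM he hl (ofDatum fc nl)

/-- **[IUTchI] Def 6.13 (ii)(c) for Def 5.5 theaters**: the `𝒟`-level gluing of the associated `𝒟`-ΘNF-Hodge theater
`dnfhtOf H` of a Definition 5.5 (iii) ΘNF-Hodge theater `H` to any `𝒟-Θ^±`-bridge via Proposition 6.7 is UNIQUE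
(`KitCore.dGluing_subsingleton`, from the derived label-rigidity law). ([IUTchI] Def 6.13 (ii) p.183) [claim: Mochizuki2012, status: disputed] -/
theorem ofDatum_dGluing_subsingleton (hM : c.ThetaAgrees M) (hl : Odd 𝔡.l) {x : K.V} (hx : x ∈ K.bad)
    (B : K.DThetaPMBridge) (H : S.ThetaNFHodgeTheater) :
    Subsingleton ((ofDatum fc nl).DThetaGluing B (dnfhtOf fc nl H) hl) :=
  KitCore.dGluing_subsingleton hM hl (ofDatum fc nl) hx B _

/-- **[IUTchI] Rmk 6.12.2 (ii) / Def 6.13 (i)(c) for Def 5.5 theaters, ℱ-level**: the gluing of a Definition 5.5 (iii)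
ΘNF-Hodge theater `H` to a Θ^±-bridge `B` (abc-iut-L5-t4's `ThetaGluing`) is UNIQUE — `𝒟`-level uniqueness transported
through the isomorphism kit `IsoKit.ofDatum` (abc-iut-w4-d056's `gluing_subsingleton_of_dGluing_subsingleton`; the
associated `𝒟`-ΘNF-Hodge theater of `H` in that kit IS `dnfhtOf H`). ([IUTchI] Def 6.13 (i) p.182) [claim: Mochizuki2012, status: disputed] -/
theorem ofDatum_gluing_subsingleton (hM : c.ThetaAgrees M) (hl : Odd 𝔡.l) {x : K.V} (hx : x ∈ K.bad)
    (B : FK.ThetaPMBridge) (H : S.ThetaNFHodgeTheater) :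
    Subsingleton ((ofDatum fc nl).ThetaGluing B H hl) :=
  PMBaseKit.S5Local.gluing_subsingleton_of_dGluing_subsingleton (ofDatum fc nl) (IsoKit.ofDatum fc nl) hl B H
    (ofDatum_dGluing_subsingleton fc nl hM hl hx B.dBridge H)

/-- **The two ΘNF-side §6 hypotheses recorded by abc-iut-L5-t4 hold together for the kit built from Def 5.5**:
`GluingTransportLaw` (Rmk 6.12.2 (i), `gluingTransportLaw_ofDatum`) and `GluingUniqueBad` (Rmk 6.12.2 (ii)) — so the §6
constructions over `N := ofDatum fc nl` (`strictify`, `toDStrict`, the Θ^{±ell}NF-Hodge theater isomorphism notions)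
run with no standing ΘNF-side hypothesis beyond the dictionaries and `ThetaAgrees`.
([IUTchI] Rmk 6.12.2 (i) p.174) [claim: Mochizuki2012, status: disputed] -/
theorem ofDatum_gluingTransportLaw_and_gluingUniqueBad (hM : c.ThetaAgrees M) (hl : Odd 𝔡.l) :
    (ofDatum fc nl).GluingTransportLaw hl ∧ (ofDatum fc nl).GluingUniqueBad hl :=
  ⟨gluingTransportLaw_ofDatum fc nl hM hl, ofDatum_gluingUniqueBad fc nl hM hl⟩

end BaseThetaDatum.S5Local

end Literature.IUT.HodgeTheaters
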